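import Mathlib
import HarnessLib
import Literature.Analysis.FluidPDE.SelfSimilar
import Literature.Analysis.FluidPDE.TypeIAncientMild
import Summits.NavierStokesRegularity.NavierStokesRegularity.Theorems.QuarterLogPincerQuietCollarDefsLog
import Summits.NavierStokesRegularity.NavierStokesRegularity.Theorems.QuarterLogPincerQuietCollarLeverExplicit

/-!
# Route `QuarterLogPincer`, crux `TypeIQuantSubcubicExp` (stmt-NavierStokesRegularity-24077), line `quiet_collar` —
# QP1 IN THE LOG-WEIGHTED TYPING, BY NAME: `stub_quietCollarLog : StubQuietCollarLog`

The re-typed QP1 `StubQuietCollarLog` (`Theorems/QuarterLogPincerQuietCollarDefsLog.lean`: the quiet collar delivered at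
level `ηq / (1 + log r)`) is exactly the statement of the landed explicit-constant lever
`…QuietCollar.quietCollar_log` (`Theorems/QuarterLogPincerQuietCollarLeverExplicit.lean`, pub-ns-dss typer g36, p685241),
so it is closed by name in one line.  This keeps QP1 CLOSED when the author rebases the line's registered stubs onto the
log-weighted objects (DIRECTOR-NS KEY-NS #187).

HONEST FRAME: a statement about HYPOTHETICAL Type-I ancient mild fields with a log-shaped cube budget; QP2, 24077, the DSS
wall W7 and Navier–Stokes regularity are OPEN / not proved.  pub-ns-dss typer (g37), `--supports 24077`.
-/

noncomputable section

set_option linter.dupNamespace false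

namespace Summit.NavierStokesRegularity.NavierStokesRegularity.Cruxes.TypeIQuantSubcubicExp.QuietCollar

open Literature.Analysis Literature.Analysis.FluidPDE

/-- **QP1 in the log-weighted typing (CLOSED BY NAME)**: every Type-I ancient mild field with the log-shaped cube budget
has, for every polynomial request, a collar at a polynomial radius on which `‖v s x‖ ≤ ηq / (1 + log r)` for all
`s ∈ [−1, −ε]` — the landed `quietCollar_log`. [folklore] -/
theorem stub_quietCollarLog : StubQuietCollarLog :=
  fun _M _v hv hB => quietCollar_log hv hB

end Summit.NavierStokesRegularity.NavierStokesRegularity.Cruxes.TypeIQuantSubcubicExp.QuietCollar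

end
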